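import Summits.QuantumAdvantage.QuantumAdvantage.Theorems.SteerDialLinear

/-!
# SteerDial (9/10): SteerDialPick

§LIN8 (core) — residue completeness of the 43 identity words of length 8 (`pickOK8_*`: for every `α ∈ 𝔽₃^8` with two nonzero
entries every residue `Σ α_j[u_j]` is realised by an identity word; kernel decision over `3^8` patterns in plain `ℕ`
arithmetic), the pattern-dependent steering word `wpick` with `wpick_idWord`, `lin_wpick`.

Part 9 of 10 of the prover-side twin of the workshop node «SteerDial» (route `SpreadDial`, node on 29065 `CoverLift3`;
lineage decomp-qadv-lens-5, generation 7).  Content verbatim from the monolithic twin `tree/SpreadDialSteer.lean` v5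
(sha256 in LAND.md, farm rc0 · 0 err · 0 warn · 0 sorry; axioms `propext`/`Classical.choice`/`Quot.sound` for every theorem),
cut at section boundaries to meet the 400-line rule.  No `def … : Prop`, no `instance`, no `notation`.
-/

set_option linter.style.longLine false
set_option linter.dupNamespace false

namespace Summit.QuantumAdvantage.QuantumAdvantage.Theorems.SteerDial

open Finset
open Literature.Computability.QuantumComplexity Literature.Computability.MetaComplexity
open Literature.Computability.QuantumComplexity.RingHLF
open Summit.QuantumAdvantage.AdviceFreeQNC0
open Summit.QuantumAdvantage.QuantumAdvantage.Theses

/-! ## §LIN8 (v6)  GLOBAL linear tests, general coefficients: `{x : Σᵢ aᵢ[xᵢ] = t}` for every `a : C_{n+8} → 𝔽₃` with two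
nonzero coefficients among eight cyclically consecutive positions — steering by PATTERN-DEPENDENT identity words of length 8 -/

section Pick

/-- Bit `j` of a code. -/
def bt (k j : ℕ) : ℕ := k / 2 ^ j % 2
/-- Words of length 8 from codes (letter `j` = bit `j`). -/
def word8 (k : ℕ) : Fin 8 → Bool := fun j => decide (bt k j.val = 1)

/-- The codes of the 43 identity words of length 8 (`T_w = 1` on all four kernel states). -/
def idCodes8 : List ℕ :=
  [0, 5, 10, 17, 20, 27, 34, 40, 45, 54, 63, 65, 68, 75, 80, 85, 90, 99, 105, 108, 119, 126, 130, 136, 141, 150, 159, 160, 165, 170,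
    177, 180, 187, 198, 207, 210, 216, 221, 231, 238, 243, 249, 252]

/-- SteerDial helper `idCodes8_idWord` (lens-5 g7 SteerDial twin; see the enclosing section docstring). -/
theorem idCodes8_idWord : ∀ k ∈ idCodes8, idWord (word8 k) = true := by decide +kernel

/-- Residue evaluator on digit vectors: `Σ_j d_j · bit_j(k) mod 3` in plain `ℕ` arithmetic (kernel-cheap). -/
def linNat (d : Fin 8 → ℕ) (k : ℕ) : ℕ :=
  (d 0 * bt k 0 + d 1 * bt k 1 + d 2 * bt k 2 + d 3 * bt k 3 + d 4 * bt k 4 + d 5 * bt k 5 + d 6 * bt k 6 + d 7 * bt k 7) % 3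

/-- The steering code for digit pattern `d` and residue `r`: the first identity code realising `r`. -/
def pick8 (d : Fin 8 → ℕ) (r : ℕ) : ℕ := (idCodes8.find? fun k => linNat d k == r).getD 0

/-- Two nonzero digits (Boolean form). -/
def twoNZ (d : Fin 8 → ℕ) : Bool := decide (∃ j₁ j₂ : Fin 8, j₁ < j₂ ∧ d j₁ ≠ 0 ∧ d j₂ ≠ 0)

/-- Base-3 digits of a pattern code. -/
def digs (c : ℕ) : Fin 8 → ℕ := fun j => c / 3 ^ j.val % 3

/-- The check at one residue: the picked code is an identity code realising `r`. -/
def okAt (d : Fin 8 → ℕ) (r : ℕ) : Bool := decide (pick8 d r ∈ idCodes8) && (linNat d (pick8 d r) == r)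

/-- SteerDial helper `okAt_spec` (lens-5 g7 SteerDial twin; see the enclosing section docstring). -/
theorem okAt_spec {d : Fin 8 → ℕ} {r : ℕ} (h : okAt d r = true) : pick8 d r ∈ idCodes8 ∧ linNat d (pick8 d r) = r := by
  unfold okAt at h
  rw [Bool.and_eq_true, decide_eq_true_eq, beq_iff_eq] at h
  exact h

/-- The completeness check at pattern code `c` (Boolean form): if two digits are nonzero, every residue is realised by an
identity code. -/
def pickOK8 (c : ℕ) : Bool := !twoNZ (digs c) || (okAt (digs c) 0 && okAt (digs c) 1 && okAt (digs c) 2)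

/-- **Residue completeness of the identity words of length 8** (kernel decision over all `3^8` coefficient patterns, in three
ranges): for every `α ∈ 𝔽₃^8` with at least two nonzero entries and every `r ∈ 𝔽₃` some identity word `u ∈ {0,1}^8` has
`Σ_j α_j [u_j] = r`.  (Length 8 is sharp for "all patterns": at length 7 the patterns `1111111`, `2222222` miss a residue, at
length 6 twenty-eight patterns do — `exp/linid.py`.) -/
theorem pickOK8_0 : ∀ c < 2187, pickOK8 c = true := by decide +kernel
/-- SteerDial helper `pickOK8_1` (lens-5 g7 SteerDial twin; see the enclosing section docstring). -/
theorem pickOK8_1 : ∀ c < 2187, pickOK8 (c + 2187) = true := by decide +kernel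
/-- SteerDial helper `pickOK8_2` (lens-5 g7 SteerDial twin; see the enclosing section docstring). -/
theorem pickOK8_2 : ∀ c < 2187, pickOK8 (c + 4374) = true := by decide +kernel

/-- SteerDial helper `pickOK8_all` (lens-5 g7 SteerDial twin; see the enclosing section docstring). -/
theorem pickOK8_all (c : ℕ) (hc : c < 6561) : pickOK8 c = true := by
  rcases Nat.lt_or_ge c 2187 with h | h
  · exact pickOK8_0 c h
  rcases Nat.lt_or_ge c 4374 with h' | h'
  · have := pickOK8_1 (c - 2187) (by omega); rwa [show c - 2187 + 2187 = c by omega] at this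
  · have := pickOK8_2 (c - 4374) (by omega); rwa [show c - 4374 + 4374 = c by omega] at this

/-- SteerDial helper `pickOK8_spec` (lens-5 g7 SteerDial twin; see the enclosing section docstring). -/
theorem pickOK8_spec {c : ℕ} (h : pickOK8 c = true) (h2 : twoNZ (digs c) = true) (r : ℕ) (hr : r < 3) :
    pick8 (digs c) r ∈ idCodes8 ∧ linNat (digs c) (pick8 (digs c) r) = r := by
  unfold pickOK8 at h
  rw [h2] at h
  simp only [Bool.not_true, Bool.false_or, Bool.and_eq_true] at h
  obtain ⟨⟨h0, h1⟩, h2'⟩ := h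
  interval_cases r
  · exact okAt_spec h0
  · exact okAt_spec h1
  · exact okAt_spec h2'

/-- Digit vector and code of a window pattern `α ∈ 𝔽₃^8`. -/
def dv (α : Fin 8 → ZMod 3) : Fin 8 → ℕ := fun j => (α j).val
/-- The base-3 code of a window pattern (`< 3^8`). -/
def code (α : Fin 8 → ZMod 3) : ℕ :=
  (α 0).val + 3 * (α 1).val + 9 * (α 2).val + 27 * (α 3).val + 81 * (α 4).val + 243 * (α 5).val + 729 * (α 6).val +
    2187 * (α 7).val

/-- SteerDial helper `code_lt` (lens-5 g7 SteerDial twin; see the enclosing section docstring). -/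
theorem code_lt (α : Fin 8 → ZMod 3) : code α < 6561 := by
  have h0 := ZMod.val_lt (α 0); have h1 := ZMod.val_lt (α 1); have h2 := ZMod.val_lt (α 2); have h3 := ZMod.val_lt (α 3)
  have h4 := ZMod.val_lt (α 4); have h5 := ZMod.val_lt (α 5); have h6 := ZMod.val_lt (α 6); have h7 := ZMod.val_lt (α 7)
  unfold code; omega

/-- SteerDial helper `digs_code` (lens-5 g7 SteerDial twin; see the enclosing section docstring). -/
theorem digs_code (α : Fin 8 → ZMod 3) : digs (code α) = dv α := by
  have h0 := ZMod.val_lt (α 0); have h1 := ZMod.val_lt (α 1); have h2 := ZMod.val_lt (α 2); have h3 := ZMod.val_lt (α 3)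
  have h4 := ZMod.val_lt (α 4); have h5 := ZMod.val_lt (α 5); have h6 := ZMod.val_lt (α 6); have h7 := ZMod.val_lt (α 7)
  funext j
  fin_cases j <;> simp [digs, code, dv] <;> omega

/-- SteerDial helper `twoNZ_dv` (lens-5 g7 SteerDial twin; see the enclosing section docstring). -/
theorem twoNZ_dv {α : Fin 8 → ZMod 3} (h : ∃ j₁ j₂ : Fin 8, j₁ < j₂ ∧ α j₁ ≠ 0 ∧ α j₂ ≠ 0) : twoNZ (dv α) = true := by
  obtain ⟨j₁, j₂, hlt, h₁, h₂⟩ := h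
  unfold twoNZ
  rw [decide_eq_true_eq]
  exact ⟨j₁, j₂, hlt, by unfold dv; rwa [Ne, ZMod.val_eq_zero], by unfold dv; rwa [Ne, ZMod.val_eq_zero]⟩

/-- The steering word for window pattern `α` and target residue `r`. -/
def wpick (α : Fin 8 → ZMod 3) (r : ZMod 3) : Fin 8 → Bool := word8 (pick8 (dv α) r.val)

/-- SteerDial helper `pick_spec` (lens-5 g7 SteerDial twin; see the enclosing section docstring). -/
theorem pick_spec {α : Fin 8 → ZMod 3} (hα : ∃ j₁ j₂ : Fin 8, j₁ < j₂ ∧ α j₁ ≠ 0 ∧ α j₂ ≠ 0) (r : ZMod 3) :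
    pick8 (dv α) r.val ∈ idCodes8 ∧ linNat (dv α) (pick8 (dv α) r.val) = r.val := by
  have hOK := pickOK8_all (code α) (code_lt α)
  have h := pickOK8_spec hOK (by rw [digs_code]; exact twoNZ_dv hα) r.val (ZMod.val_lt r)
  rwa [digs_code] at h

/-- SteerDial helper `wpick_idWord` (lens-5 g7 SteerDial twin; see the enclosing section docstring). -/
theorem wpick_idWord {α : Fin 8 → ZMod 3} (hα : ∃ j₁ j₂ : Fin 8, j₁ < j₂ ∧ α j₁ ≠ 0 ∧ α j₂ ≠ 0) (r : ZMod 3) :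
    idWord (wpick α r) = true :=
  idCodes8_idWord _ (pick_spec hα r).1

/-- Bridge between the `𝔽₃`-form and the `ℕ`-evaluator. -/
theorem lin_word8 (α : Fin 8 → ZMod 3) (k : ℕ) : lin α (word8 k) = ((linNat (dv α) k : ℕ) : ZMod 3) := by
  have hterm : ∀ j : Fin 8, (if word8 k j then α j else 0) = (((α j).val * bt k j.val : ℕ) : ZMod 3) := by
    intro j
    have hb : bt k j.val = 0 ∨ bt k j.val = 1 := Nat.mod_two_eq_zero_or_one _
    rcases hb with h | h <;> simp [word8, h]
  unfold lin linNat
  rw [Fin.sum_univ_eight, ZMod.natCast_mod]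
  simp only [hterm, dv]
  push_cast
  rfl

/-- SteerDial helper `lin_wpick` (lens-5 g7 SteerDial twin; see the enclosing section docstring). -/
theorem lin_wpick {α : Fin 8 → ZMod 3} (hα : ∃ j₁ j₂ : Fin 8, j₁ < j₂ ∧ α j₁ ≠ 0 ∧ α j₂ ≠ 0) (r : ZMod 3) :
    lin α (wpick α r) = r := by
  unfold wpick
  rw [lin_word8, (pick_spec hα r).2, ZMod.natCast_zmod_val]

end Pick

end Summit.QuantumAdvantage.QuantumAdvantage.Theorems.SteerDial
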